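import Summits.Ventures.HodgeRepro.Night1AndreDirectSum

/-!
# S3 (André 1992 / Milne 2020 Theorem 1) for the corner products themselves: the Hodge classes of
`B = ∏_i A_{T i}` are the direct sum, over the Galois orbits of Pohlmann sets `Δ ⊆ ι × G`, of pulled-back Weil
spaces — and the Weil lines of `B` are the `Δ = lineSet σ` pieces

Blind re-derivation cell `pub-hodge-repro`, seat `night-1` (gen 6).  Imports night-1's `Night1AndreDirectSum`
(Theorem 1 on a finite `G`-set `X`, its Galois-orbit direct-sum form and the dimension count).  Namespace
`HodgeRepro.RouteC`.

Theorem 1 was proved on an arbitrary finite `G`-set `X` (the embeddings of a CM algebra).  The CM algebra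
of the corner product `B = ∏_i A_{T i}` (night-1's model of S4's objects) is `F^ι`, with embeddings `ι × G` on
which `G` acts on the embedding coordinate — `prodRightAction`, `g • (i, x) = (i, g x)` (typer's `prodSmul`
on sets) — and CM type `prodTypeSet T`.  With that action:

* `smul_prodTypeSet` — the Galois translates of the product type are the product types of the translated
  corners, so typer-2's joint eigenspace of `B` IS the `G`-set joint eigenspace of `(ι × G, prodTypeSet T)`
  (`jointEigenspaceOn_prod_eq`); `isCMTypeOn_prodTypeSet`; **`isHodgeSetOn_prodTypeSet_iff`** — Pohlmann's
  condition on the `G`-set `ι × G` is typer's product condition `IsHodgeSetProd`;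
* **`jointEigenspaceOn_prod_eq_iSup_map_andrePull`** — THEOREM 1 FOR `B`: every Hodge class of the corner
  product is a sum of pull-backs, along the diagonals `B → B_Δ = ∏_{(i,x) ∈ Δ} A_{T i · x⁻¹}`, of Weil classes
  of the corner products `B_Δ` over the Pohlmann `2p`-sets `Δ ⊆ ι × G`; **`jointEigenspaceOn_prod_eq_iSup_orbitSpan`**
  + **`iSupIndep_orbitSpan_prod`** — the direct-sum form; `finrank_jointEigenspaceOn_prod` — its dimension is
  typer's Pohlmann count on `ι × G`;
* `cornerType_prodTypeSet` — the corners of `B_Δ` are the right translates `T i · x⁻¹` (typer's `rmul`);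
  **`andrePull_lineSet_weilWedgeProd`** — for `Δ = lineSet σ` the pull-back of the `1`-line of `B_{lineSet σ}`
  is the `σ`-line `weilWedgeProd e σ` of `W_F(B)` itself: the Weil lines of `B` are the `Δ = lineSet σ` pieces
  of Theorem 1 (consistency of S3 with S1/S4 on the model).

Nothing geometric is built; every statement is about coordinate wedges on the finite `G`-set `ι × G`.
Nothing here says anything about the status of the Hodge conjecture for CM abelian varieties, which is NOT
proved.
-/

set_option autoImplicit false

open Finset Module
open scoped Pointwise

namespace HodgeRepro.RouteC

open CMHodgeOn

section Product

variable {G : Type*} [Group G] [DecidableEq G] [Fintype G] {ι : Type*} [Fintype ι] [DecidableEq ι]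

/-- The Galois action on the embeddings `ι × G` of the CM algebra `F^ι` of a corner product: on the embedding
coordinate, `g • (i, x) = (i, g x)` (typer's `prodSmul` on sets).  A `def` used as a LOCAL instance: `ι` itself
carries no action, so Mathlib's product instance does not apply. -/
abbrev prodRightAction (ι G : Type*) [Group G] : MulAction G (ι × G) where
  smul g q := (q.1, g * q.2)
  one_smul q := by
    show (q.1, 1 * q.2) = q
    rw [one_mul]
  mul_smul g h q := by
    show (q.1, (g * h) * q.2) = (q.1, g * (h * q.2))
    rw [mul_assoc]

attribute [local instance] prodRightAction

omit [DecidableEq G] [Fintype G] [Fintype ι] [DecidableEq ι] in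
/-- The action, pointwise. -/
@[simp] theorem prodRightAction_smul (g : G) (q : ι × G) : g • q = (q.1, g * q.2) := rfl

/-- **The Galois translates of the product type are the product types of the translated corners.** -/
theorem smul_prodTypeSet (T : ι → Finset G) (g : G) :
    g • prodTypeSet T = prodTypeSet fun i => g • T i := by
  ext q
  rw [← Finset.inv_smul_mem_iff, mem_prodTypeSet, mem_prodTypeSet, prodRightAction_smul,
    ← Finset.inv_smul_mem_iff]
  rfl

/-- Typer-2's joint eigenspace of the product is the `G`-set joint eigenspace of `(ι × G, prodTypeSet T)`. -/
theorem jointEigenspaceOn_prod_eq (T : ι → Finset G) (n p : ℕ) :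
    jointEigenspaceOn (fun g : G => prodTypeSet fun i => g • T i) n p =
      jointEigenspaceOn (fun g : G => g • prodTypeSet T) n p := by
  simp only [smul_prodTypeSet]

omit [DecidableEq ι] in
/-- The product type of a family of CM types is a CM type on the `G`-set `ι × G`. -/
theorem isCMTypeOn_prodTypeSet {c : G} {T : ι → Finset G} (hT : ∀ i, IsCMType c (T i)) :
    IsCMTypeOn c (prodTypeSet T) := by
  intro q
  rw [mem_prodTypeSet, mem_prodTypeSet, prodRightAction_smul]
  exact hT q.1 q.2

/-- `|Δ ∩ g • Φ_prod| = #{q ∈ Δ : g⁻¹ q.2 ∈ T q.1}` (typer-2's `card_inter_prodTypeSet_smul` on the `G`-set). -/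
theorem card_inter_smul_prodTypeSet (T : ι → Finset G) (Δ : Finset (ι × G)) (g : G) :
    (Δ ∩ g • prodTypeSet T).card = (Δ.filter fun q => g⁻¹ * q.2 ∈ T q.1).card := by
  rw [smul_prodTypeSet, card_inter_prodTypeSet_smul]

/-- `|Δ ∩ g • c • Φ_prod| = #{q ∈ Δ : g⁻¹ q.2 ∈ c • T q.1}`. -/
theorem card_inter_smul_conj_prodTypeSet (T : ι → Finset G) (Δ : Finset (ι × G)) (c g : G) :
    (Δ ∩ g • c • prodTypeSet T).card = (Δ.filter fun q => g⁻¹ * q.2 ∈ c • T q.1).card := by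
  rw [smul_smul, card_inter_smul_prodTypeSet]
  refine congrArg Finset.card (Finset.filter_congr fun q _ => ?_)
  rw [mul_inv_rev, mul_assoc]
  show c⁻¹ • (g⁻¹ * q.2) ∈ T q.1 ↔ g⁻¹ * q.2 ∈ c • T q.1
  exact Finset.inv_smul_mem_iff

/-- **Pohlmann's condition on the `G`-set `ι × G` is typer's product condition.** -/
theorem isHodgeSetOn_prodTypeSet_iff (c : G) (T : ι → Finset G) (Δ : Finset (ι × G)) :
    IsHodgeSetOn c (prodTypeSet T) Δ ↔ IsHodgeSetProd c T Δ := by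
  rw [isHodgeSetOn_iff_forall_inter_eq]
  unfold IsHodgeSetProd
  constructor
  · intro h τ
    have := h τ⁻¹
    rwa [card_inter_smul_prodTypeSet, card_inter_smul_conj_prodTypeSet, inv_inv] at this
  · intro h g
    rw [card_inter_smul_prodTypeSet, card_inter_smul_conj_prodTypeSet]
    exact h g⁻¹

/-- **THEOREM 1 FOR THE CORNER PRODUCT**: the Hodge classes of `B = ∏_i A_{T i}` in degree `2p` (typer-2's joint
`(p, p)`-eigenspace of the conjugate cocharacters of the product type) are the sum, over the Pohlmann
`2p`-sets `Δ ⊆ ι × G` (typer's `IsHodgeSetProd`), of the pull-backs of the Weil spaces of the corner products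
`B_Δ = ∏_{(i,x) ∈ Δ} A_{T i · x⁻¹}` along the diagonals. -/
theorem jointEigenspaceOn_prod_eq_iSup_map_andrePull {c : G} (hc : IsComplexConj c) {T : ι → Finset G}
    (hT : ∀ i, IsCMType c (T i)) (p : ℕ) :
    jointEigenspaceOn (fun g : G => prodTypeSet fun i => g • T i) (2 * p) p =
      ⨆ (Δ : Finset (ι × G)) (e : Fin (2 * p) ≃ ↥Δ) (_ : IsHodgeSetProd c T Δ),
        (weilSpaceProd G p e).map (andrePull Δ (2 * p)) := by
  rw [jointEigenspaceOn_prod_eq, jointEigenspaceOn_eq_iSup_map_andrePull hc (isCMTypeOn_prodTypeSet hT) p]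
  simp only [isHodgeSetOn_prodTypeSet_iff]

/-- The direct-sum form for the corner product: `B^p(B) ⊗ ℂ = ⨆_{O} orbitSpan O` over the Galois orbits of
Pohlmann `2p`-sets of `(ι × G, prodTypeSet T)`. -/
theorem jointEigenspaceOn_prod_eq_iSup_orbitSpan {c : G} (hc : IsComplexConj c) {T : ι → Finset G}
    (hT : ∀ i, IsCMType c (T i)) (p : ℕ) :
    jointEigenspaceOn (fun g : G => prodTypeSet fun i => g • T i) (2 * p) p =
      ⨆ (O) (_ : O ∈ pohlmannOrbits c (prodTypeSet T) p), orbitSpan O (2 * p) := by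
  rw [jointEigenspaceOn_prod_eq]
  exact jointEigenspaceOn_eq_iSup_orbitSpan hc (isCMTypeOn_prodTypeSet hT) p

/-- The summands are independent. -/
theorem iSupIndep_orbitSpan_prod (c : G) (T : ι → Finset G) (p : ℕ) :
    iSupIndep fun O : ↥(pohlmannOrbits c (prodTypeSet T) p) => orbitSpan O.1 (2 * p) :=
  iSupIndep_orbitSpan c (prodTypeSet T) p

/-- The dimension of the space of Hodge classes of the corner product is Pohlmann's count on `ι × G`. -/
theorem finrank_jointEigenspaceOn_prod {c : G} (hc : IsComplexConj c) {T : ι → Finset G}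
    (hT : ∀ i, IsCMType c (T i)) (p : ℕ) :
    finrank ℂ (jointEigenspaceOn (fun g : G => prodTypeSet fun i => g • T i) (2 * p) p) =
      hodgeCountOn c (prodTypeSet T) p := by
  rw [jointEigenspaceOn_prod_eq]
  exact finrank_jointEigenspaceOn hc (isCMTypeOn_prodTypeSet hT) p

/-- The corners of `B_Δ`: Milne's `φ_{(i,x)}` for the product type is the right translate `T i · x⁻¹`
(typer's `rmul`). -/
theorem cornerType_prodTypeSet (T : ι → Finset G) (i : ι) (x : G) :
    cornerType (prodTypeSet T) (i, x) = rmul (T i) x⁻¹ := by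
  ext t
  rw [mem_cornerType, mem_prodTypeSet, prodRightAction_smul, mem_rmul, inv_inv]

/-- The enumeration of the `σ`-line set `lineSet σ ⊆ ι × G` by `Fin (2p)` induced by an enumeration `e` of
the corners. -/
noncomputable def lineEquiv {p : ℕ} (e : Fin (2 * p) ≃ ι) (σ : G) : Fin (2 * p) ≃ ↥(lineSet (ι := ι) σ) :=
  Equiv.ofBijective (fun j => ⟨(e j, σ), by rw [mem_lineSet]⟩)
    ((Fintype.bijective_iff_injective_and_card _).2
      ⟨fun a b h => e.injective (Prod.mk.inj (Subtype.mk.inj h)).1,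
        by rw [Fintype.card_fin, Fintype.card_coe, card_lineSet, Fintype.card_congr e.symm, Fintype.card_fin]⟩)

/-- **The Weil lines of `B` are the `Δ = lineSet σ` pieces of Theorem 1**: the pull-back of the `1`-line of
the corner product `B_{lineSet σ} = ∏_i A_{T i · σ⁻¹}` along the diagonal is the `σ`-line of `W_F(B)`. -/
theorem andrePull_lineSet_weilWedgeProd {p : ℕ} (e : Fin (2 * p) ≃ ι) (σ : G) :
    andrePull (lineSet (ι := ι) σ) (2 * p) (weilWedgeProd (lineEquiv e σ) (1 : G)) = weilWedgeProd e σ := by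
  rw [andrePull_weilWedgeProd]
  unfold weilWedgeProd
  congr 1
  funext j
  simp only [deltaEnum, lineEquiv, Equiv.ofBijective_apply, prodRightAction_smul, one_mul, lineEnum]

end Product

end HodgeRepro.RouteC
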